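import Literature.Computability.MetaComplexity.MCSPProofs
import Literature.Computability.MetaComplexity.TruthTablesProofs
import Literature.Computability.Complexity.EquivalenceProblemsUPSubsetRPProofs
import Literature.Computability.Complexity.PRelHierarchy
import HarnessLib

/-!
# Crux `UniformMagnification` (stmt-PneNP-16047, route UniformStream), line `registered`,
# stub `stub_goodProg`: good programs of the circuit-evaluation machine

The streaming algorithm for `MCSP[s]` of the line keeps as its state a PROGRAM `D` of the tree's
circuit-evaluation machine (`CircuitEval.lean`, `CircuitEvalPrograms.lean`: opcodes `11 = ROT`,
`10 = BACK`, `01 = READ`, `00 t₀t₁t₂t₃ = TAB`; `CircEval.evalFn ⟨x, D⟩ ∈ FP` evaluates `D` on the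
input word `x`). A program is *good for size `t` at arity `n`* if it is clean (`CircEval.isClean`)
and either has at most `t` table instructions with `t ≠ 0`, or is a bare rotation code
`CircEval.rotCode k = (11)ᵏ` with `k < n` (a projection, of circuit complexity `0`) — exactly the
`SIZE ∨ PROJ` device of the `NP`-verifier of `MCSP` (`MCSPProofs.lean`). The stub `stub_goodProg`
is the conjunction of

* soundness (`gp_sound`): a good program computes a function of `B₂`-complexity `≤ t` — Theorem R
  of `CircuitEvalPrograms.lean` (`CircEval.exists_circuit_evalFn`: size `≤ max (#TAB D) 1 ≤ t`), and
  rotation codes compute projections (`CircEval.vmSpec_rotCode_proj`), of complexity `0` through the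
  gate-free circuit `Circuit.input`;
* completeness with a length bound (`gp_complete`): an optimal `B₂`-circuit `C` of `f`
  (`exists_computes_B2_size_eq_holds`) of size `≥ 1` has the clean program `CircEval.progOf C`
  (`vmSpec_progOf`, `#TAB = |C|`, `length_progOf_le`); of size `0` the function is a projection
  `x ↦ x j`, computed by `rotCode (n - 1 - j)` of length `≤ 2 n`;
* `P`-decidability of the good-program language (`gp_mem_P`), words `⟨⟨u, v⟩, D⟩` with `n = |u|`,
  `t = |v|` read by the total projections `fstP`/`sndP`: a Boolean combination (`setOf_and_mem_P`,
  `setOf_or_mem_P` of `FortnowGrochowUP`, i.e. `inter_mem_P`, `union_mem_P`) of equality tests of `FP` maps (`setOf_apply_eq_apply_mem_P`; the transducers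
  `MCSPVerif.cleanT`, `MCSPVerif.tabMarksT`, `onesFn`, `isNilFn`) and length tests (`LenLe`, `LenLt`
  under `fanoutFn`), as in `MCSPVerif.SIZE_mem_P` / `MCSPVerif.PROJ_mem_P`; under cleanness a program
  is a rotation code `rotCode k`, `k < n`, iff it is all ones of length `< 2 n`
  (`MCSPVerif.eq_rotCode_of_isClean`).

References: S. Arora, B. Barak, *Computational Complexity: A Modern Approach*, CUP 2009, Rem. 6.4
(circuit evaluation in `P`), Ex. 6.6, §1.3 [AroraBarakCC2009]; V. Kabanets, J.-Y. Cai, *Circuit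
minimization problem*, STOC 2000, §2 (`MCSP ∈ NP`, the certificate check).
-/

namespace Summit.PneNP.PneNP.Cruxes.UniformMagnification.Birth

set_option linter.dupNamespace false -- `Summit.PneNP.PneNP.…`: summit = sub-problem (D-0017)

open _root_.Computability
open Literature.Computability.Complexity Literature.Computability.MetaComplexity
open Literature.Computability.Complexity.CircEval Literature.Computability.MetaComplexity.MCSPVerif
open Literature.Computability.Complexity.FortnowGrochowUP (mem_P_congr setOf_and_mem_P setOf_or_mem_P
  setOf_apply_mem_mem_P)

/-! ### Soundness -/

/-- The evaluator's Boolean answer on `⟨w, D⟩` in terms of the machine's functional semantics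
(`CircEval.evalFn_boolPair`). [folklore] -/
theorem gp_headD_evalFn (w D : List Bool) :
    (evalFn (boolPair w D)).headD false = (vmSpec D (layV [] w) [] []).1.headD false := by
  rw [evalFn_boolPair, List.headD_cons]

/-- **Soundness of good programs**: a clean program with `#TAB ≤ t ≠ 0`, or a rotation code
`rotCode k` with `k < n`, computes at arity `n` a function of `B₂`-complexity `≤ t` (Theorem R
`CircEval.exists_circuit_evalFn`; `CircEval.vmSpec_rotCode_proj` and the gate-free circuit
`Circuit.input`). [cite: AroraBarakCC2009, Rem. 6.4 and Ex. 6.6] -/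
theorem gp_sound (n t : ℕ) (D : List Bool) (hD : isClean D = true)
    (hgood : tabCount D ≤ t ∧ t ≠ 0 ∨ ∃ k < n, D = rotCode k) :
    circuitSizeOver B2 (fun x : Fin n → Bool => (evalFn (boolPair (List.ofFn x) D)).headD false) ≤ t := by
  rcases hgood with ⟨ht, ht0⟩ | ⟨k, hk, rfl⟩
  · obtain ⟨C, hB, hsize, hC⟩ := exists_circuit_evalFn n D hD
    refine (circuitSizeOver_le_of_computes C hB fun x => ?_).trans
      (hsize.trans (max_le ht (Nat.one_le_iff_ne_zero.2 ht0)))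
    show C.eval x = (evalFn (boolPair (List.ofFn x) D)).headD false
    rw [hC x, List.headD_cons]
  · refine (circuitSizeOver_le_of_computes (Circuit.input ⟨n - 1 - k, by omega⟩)
      (fun g hg => by simp [Circuit.input] at hg) fun x => ?_).trans (by simp)
    show (Circuit.input _).eval x = (evalFn (boolPair (List.ofFn x) (rotCode k))).headD false
    rw [Circuit.eval_input, gp_headD_evalFn, vmSpec_rotCode_proj k hk]

/-! ### Completeness -/

/-- **Completeness of good programs**: a function of `B₂`-complexity `≤ t` at arity `n` has a good
program for size `t` of length `≤ (t + 1) (8 (n + t) + 10) + 2 n` — the program `CircEval.progOf C`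
of an optimal circuit `C` (`exists_computes_B2_size_eq_holds`, `CircEval.vmSpec_progOf`,
`CircEval.length_progOf_le`), or, if `C` has no gate (then `f = x_j`), the rotation code
`rotCode (n - 1 - j)`. [cite: AroraBarakCC2009, Rem. 6.4 and Ex. 6.6] -/
theorem gp_complete (n t : ℕ) (f : (Fin n → Bool) → Bool) (hf : circuitSizeOver B2 f ≤ t) :
    ∃ D : List Bool, isClean D = true ∧ (tabCount D ≤ t ∧ t ≠ 0 ∨ ∃ k < n, D = rotCode k) ∧
      (fun x : Fin n → Bool => (evalFn (boolPair (List.ofFn x) D)).headD false) = f ∧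
      D.length ≤ (t + 1) * (8 * (n + t) + 10) + 2 * n := by
  obtain ⟨C, hB, hCf, hCs⟩ := exists_computes_B2_size_eq_holds f
  have hCle : C.size ≤ t := hCs ▸ hf
  by_cases h0 : C.size = 0
  · -- no gate: `f` is the projection to the output wire, an input
    have hg : C.gates = [] := List.eq_nil_of_length_eq_zero h0
    obtain ⟨j, hj⟩ : ∃ j : Fin n, C.output = .inl j := by
      cases ho : C.output with
      | inl j => exact ⟨j, rfl⟩
      | inr m => exact absurd (C.wf_output m ho) (by simp [hg])
    have hfj : ∀ v, f v = v j := fun v => by rw [← hCf v]; simp [Circuit.eval, hj]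
    have hjn : (j : ℕ) < n := j.isLt
    refine ⟨rotCode (n - 1 - j), isClean_rotCode _, Or.inr ⟨n - 1 - j, by omega, rfl⟩,
      funext fun v => ?_, ?_⟩
    · show (evalFn (boolPair (List.ofFn v) (rotCode (n - 1 - j)))).headD false = f v
      rw [gp_headD_evalFn, vmSpec_rotCode_proj (n - 1 - j) (by omega), hfj]
      congr 1
      exact Fin.ext (by simp; omega)
    · rw [length_rotCode]; omega
  · -- at least one gate: the program of `C`
    refine ⟨progOf C, isClean_progOf C, Or.inl ⟨by rw [tabCount_progOf]; exact hCle, by omega⟩,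
      funext fun v => ?_, ?_⟩
    · show (evalFn (boolPair (List.ofFn v) (progOf C))).headD false = f v
      rw [gp_headD_evalFn, vmSpec_progOf C (arity_le_of_isOver hB), hCf]
    · exact (length_progOf_le C).trans
        ((Nat.mul_le_mul (by omega) (by omega)).trans (Nat.le_add_right _ _))

/-! ### The good-program language is in `P` -/

/-- Rotation codes are all-ones words: `rotCode k = 1^{2k}`. [folklore] -/
theorem gp_rotCode_eq_replicate (k : ℕ) : rotCode k = List.replicate (2 * k) true := by
  induction k with
  | zero => rfl
  | succ k ih => rw [rotCode, ih]; simp [List.replicate_succ, Nat.mul_succ]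

/-- Under cleanness, a program is a rotation code `rotCode k` with `k < n` iff it is all ones of
length `< 2 n` (`MCSPVerif.eq_rotCode_of_isClean`). [folklore] -/
theorem gp_exists_rotCode_iff (n : ℕ) (D : List Bool) (hD : isClean D = true) :
    (∃ k < n, D = rotCode k) ↔ D = List.replicate D.length true ∧ D.length < 2 * n := by
  constructor
  · rintro ⟨k, hk, rfl⟩
    rw [length_rotCode]
    exact ⟨gp_rotCode_eq_replicate k, by omega⟩
  · rintro ⟨h1, h2⟩
    exact ⟨D.length / 2, by omega, eq_rotCode_of_isClean D.length D le_rfl h1 hD⟩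

/-- `CLEAN`: `{w | isClean (sndP w)} ∈ P`, by the transducer `cleanT` (`MCSPVerif.cleanT_eval`,
`setOf_apply_eq_apply_mem_P`). [folklore] -/
theorem gp_clean_mem_P : ({w | isClean (sndP w) = true} : Language Bool) ∈ Classes.P :=
  mem_P_congr
    (setOf_apply_eq_apply_mem_P (comp_mem_FP cleanT_mem_FP sndP_mem_FP) (const_mem_FP [true]))
    fun w => by simp [cleanT_eval]

/-- `#TAB D ≤ |v|`: a length comparison of the `FP` images `1^{#TAB D}` (`MCSPVerif.tabMarksT_eval`)
and `v` (`LenLe`, `preimage_mem_P`, `fanoutFn_mem_FP`). [folklore] -/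
theorem gp_tab_mem_P :
    ({w | tabCount (sndP w) ≤ (sndP (fstP w)).length} : Language Bool) ∈ Classes.P :=
  mem_P_congr
    (setOf_apply_mem_mem_P (LenLe_mem_P Polynomial.X)
      (fanoutFn_mem_FP (comp_mem_FP sndP_mem_FP fstP_mem_FP) (comp_mem_FP tabMarksT_mem_FP sndP_mem_FP)))
    fun w => by simp [tabMarksT_eval, ones]

/-- `|v| ≠ 0`: the test `isNilFn` on `v` answers `[0]` (`setOf_apply_eq_apply_mem_P`). [folklore] -/
theorem gp_pos_mem_P : ({w | (sndP (fstP w)).length ≠ 0} : Language Bool) ∈ Classes.P :=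
  mem_P_congr
    (setOf_apply_eq_apply_mem_P (comp_mem_FP Brick.isNilFn_mem_FP (comp_mem_FP sndP_mem_FP fstP_mem_FP))
      (const_mem_FP [false]))
    fun w => by simp [Brick.isNilFn]

/-- `D = 1^{|D|}`: the equality test `D = onesFn D` (`setOf_apply_eq_apply_mem_P`). [folklore] -/
theorem gp_ones_mem_P :
    ({w | sndP w = List.replicate (sndP w).length true} : Language Bool) ∈ Classes.P :=
  mem_P_congr (setOf_apply_eq_apply_mem_P sndP_mem_FP (comp_mem_FP onesFn_mem_FP sndP_mem_FP))
    fun w => by simp [onesFn, OracleCompose.unaryEncodeNat_eq_replicate]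

/-- `|D| < 2 |u|`: a strict length comparison (`LenLt (2X)`, `preimage_mem_P`, `fanoutFn_mem_FP`).
[folklore] -/
theorem gp_short_mem_P :
    ({w | (sndP w).length < 2 * (fstP (fstP w)).length} : Language Bool) ∈ Classes.P :=
  mem_P_congr
    (setOf_apply_mem_mem_P (LenLt_mem_P (2 * Polynomial.X))
      (fanoutFn_mem_FP (comp_mem_FP fstP_mem_FP fstP_mem_FP) sndP_mem_FP))
    fun _ => by simp

/-- **The good-program language is in `P`**: the set of words `w = ⟨⟨u, v⟩, D⟩` with `D` clean and
(`#TAB D ≤ |v| ≠ 0`, or `D = rotCode k` with `k < |u|`) is a Boolean combination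
(`setOf_and_mem_P`, `setOf_or_mem_P`) of the five `P`-tests above, the rotation-code clause
being replaced under cleanness by "all ones of length `< 2 |u|`" (`gp_exists_rotCode_iff`) — as
`MCSPVerif.SIZE_mem_P`, `MCSPVerif.PROJ_mem_P`. [cite: AroraBarakCC2009, §1.3] -/
theorem gp_mem_P :
    {w : List Bool | CircEval.isClean (sndP w) = true ∧
        (CircEval.tabCount (sndP w) ≤ (sndP (fstP w)).length ∧ (sndP (fstP w)).length ≠ 0 ∨
          ∃ k < (fstP (fstP w)).length, sndP w = CircEval.rotCode k)} ∈ Classes.P :=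
  mem_P_congr
    (setOf_and_mem_P gp_clean_mem_P
      (setOf_or_mem_P (setOf_and_mem_P gp_tab_mem_P gp_pos_mem_P)
        (setOf_and_mem_P gp_ones_mem_P gp_short_mem_P)))
    fun _ => and_congr_right fun hD => or_congr Iff.rfl (gp_exists_rotCode_iff _ _ hD)

/-! ### The stub -/

/-- **stub_goodProg** — `GoodProgSpec` unfolded: (i) a good program computes a function of `B₂`-complexity
`≤ t` (`CircEval.exists_circuit_evalFn`: size `≤ max (#TAB) 1 ≤ t`; rotation codes compute projections,
`CircEval.vmSpec_rotCode_proj`, complexity `0` by `Circuit.input`); (ii) completeness: an optimal circuit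
(`exists_computes_B2_size_eq_holds`) of size `≥ 1` has the clean program `CircEval.progOf C`
(`vmSpec_progOf`, `length_progOf_le`, `#TAB = size`), of size `0` it is a projection (`rotCode`, length
`≤ 2n`); (iii) the good-program language is in `P` by the transducers `cleanT`, `tabMarksT` of `MCSPProofs`,
length comparisons (`LenLe`, `LenLt`), the pattern test of `MCSPVerif.PROJ`, and closure of `P` under `∩, ∪`
and `FP`-preimages (`fstP`, `sndP`) — `gp_sound`, `gp_complete`, `gp_mem_P`.
[cite: AroraBarakCC2009, Rem. 6.4 and Ex. 6.6] -/
theorem stub_goodProg :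
    (∀ (n t : ℕ) (D : List Bool), CircEval.isClean D = true →
        (CircEval.tabCount D ≤ t ∧ t ≠ 0 ∨ ∃ k < n, D = CircEval.rotCode k) →
        circuitSizeOver B2
          (fun x : Fin n → Bool => (CircEval.evalFn (boolPair (List.ofFn x) D)).headD false) ≤ t) ∧
    (∀ (n t : ℕ) (f : (Fin n → Bool) → Bool), circuitSizeOver B2 f ≤ t →
        ∃ D : List Bool, CircEval.isClean D = true ∧
          (CircEval.tabCount D ≤ t ∧ t ≠ 0 ∨ ∃ k < n, D = CircEval.rotCode k) ∧
          (fun x : Fin n → Bool => (CircEval.evalFn (boolPair (List.ofFn x) D)).headD false) = f ∧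
          D.length ≤ (t + 1) * (8 * (n + t) + 10) + 2 * n) ∧
    {w : List Bool | CircEval.isClean (sndP w) = true ∧
        (CircEval.tabCount (sndP w) ≤ (sndP (fstP w)).length ∧ (sndP (fstP w)).length ≠ 0 ∨
          ∃ k < (fstP (fstP w)).length, sndP w = CircEval.rotCode k)} ∈ Classes.P :=
  ⟨gp_sound, gp_complete, gp_mem_P⟩

end Summit.PneNP.PneNP.Cruxes.UniformMagnification.Birth
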